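import Literature.MathematicalPhysics.QuantumFieldTheory.Balaban1983to89.B9RWSumsCompleteGeo9YPairM
import Literature.MathematicalPhysics.QuantumFieldTheory.Balaban1983to89.B9RWSumsDefinitePinsPair
import Literature.MathematicalPhysics.QuantumFieldTheory.Balaban1983to89.B9RWSumsDefinitePinsNbr
import Literature.MathematicalPhysics.QuantumFieldTheory.Balaban1983to89.B9RWSumsDefinitePins

/-!
# `Balaban1983to89.B9RWSumsDefinitePinsPair` — rows 13 ∕ 18 ∕ 19 of the N06 census as ONE face at def-Y's members with DEFINITE constants, the
# (3.43)–(3.46) co-readings sited on the neighbourhood (radius 2) AND the printed second-order L² members (3.46)₃,₅ as DIRECTION-PAIR FAMILIES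
# (the `Pair` twin of `B9RWSumsDefinitePinsNbr`)

T. Bałaban, *Propagators for lattice gauge theories in a background field*, Commun. Math. Phys. **99** (1985) 389–434
[`Balaban1985BackgroundPropagators`, "B9"], Thm 3.7 p. 409, Cor. 3.8 p. 410, Thm 3.10 pp. 415–416, Thm 3.1 p. 397, (3.46) p. 398 ll. 19–22 (the
printed second-order members ‖h∇_U∇_UG′λ‖, ‖hG′∇\*_U∇\*_Uλ‖ — lit-balaban desk reading); [4] = T. Bałaban, *Propagators and renormalization
transformations for lattice gauge theories. II*, Commun. Math. Phys. **96** (1984) 223–250 [`Balaban1984PropagatorsII`], Lemma 2.1 pp. 233–234.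

statement-level skeleton of published theorems with citation tags; proofs where landed; nothing here is a claim about the
Yang–Mills mass gap

WHY THIS FILE (v4 = `B9RWSumsDefinitePinsPair` with the MIXED members — L² K-index 3 and (3.44)∕(3.45) — on the pair family; this seat's located
point (O4′): the one-slot coordinate letters are slice-diagonal).  `B9RWSumsDefinitePinsNbr.rows131819_definite_geo9Y_nbr` (the knit's rows-18∕19
face before v3.1) still models two of the weight-1 L² lines by
the LAPLACIAN composites `Lap ∘ₗ G`, `G ∘ₗ Lap` — trace consequences, not the printed members (this seat's located point (O3), desk verdict
option (b)).  THIS FILE is the same face on `B9RWSumsAllBlocksPairM` ∕ `B9RWSumsCompleteGeo9YPairM`: the two-direction lines are the PAIR FAMILIES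
∇_{U,ν}∇_{U,μ}G and G∇\*_{U,ν}∇\*_{U,μ} packaged by `familyOp` on the product lattice `X × (Q × Q)` (direction letters `DirOps37`∕`DirOps310`,
hypothesis schemas `L2SecondLegs…`, `FactorsL2Second…`, `DirTranspose…` of printed shape); the three new primitive constants of each side are one
sign record `PairPrims` (N₃, B₃, θ₃ ≥ 0) and the direction count bound `NQ ≥ 0`; the shared all-blocks constant absorbs them through
`B1Pair := B1Y + NQ·(secondConst_{G′} + secondConst_G)` scaled by `nbrScale` as before.  K-INDEX CONVENTION (v3.1 of the leaves): the index `n : Fin 6` of `K.l2 n` follows def-Y's instance `Node00.OpsYOfLetters.kernelFamilyB.l2` — n = 3 ↦ ‖h∇G∇\*λ‖ (mixed member, one-slot model `D ∘ₗ (G ∘ₗ Dstar)`, blocks `blkY`), n = 4 ↦ ‖h∇∇Gλ‖ (pair family `familyOp … DdDd ∘ G`), n = 5 ↦ ‖hG∇\*∇\*λ‖ (pair family `familyOp … G ∘ DsdDsd`); the printed bound is the same for the three.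

* §1 ★ `MixedPrims` (+ `.OK`), `B1PairM`, ★ `E37YPairM`, ★ `E310YPairM` (pin targets for `(ops x).E37` ∕ `(ops x).E310`).
* §2 ★★★ `rows131819_definite_geo9Y_pairM` — `Thm37Printed ∧ Cor38Printed ∧ Thm310Printed ∧ RWSumsYieldIneqs` at the `PairM` E-letters; binder
  classes = `rows131819_definite_geo9Y_nbr`'s with: `(p3 q3 : PairPrims) (hp3 hq3) (NQ) (hNQ0)`; direction index types `Q QA` + letters `𝔡 𝔡A`;
  `SL SLA` ↦ `S3 S3A`; `hcntL hcntLA` ↦ `hcnt3 hcnt3A` + `hNQ hNQA`; the `LapLegs` conjunct of `h36H h36HA` ↦ the triple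
  `L2SecondLegs ∧ FactorsL2Second ∧ DirTranspose`; `hadjL hadjLA` GONE; `hl4 hl5 hlA4 hlA5` on the `familyOp` pair families, `hl3 hlA3` the
  mixed member on the one-slot model.

HONEST SCOPE.  Definitions by choice and kernel bookkeeping; nothing of [B9] or [4] asserted; every remaining hypothesis is operator-level, a
co-reading schema, a letter, a count or a sign.  NOT a node discharge; count-neutral; one finite 𝕋^{d+1} programme at fixed ε — nothing continuum,
nothing about the mass gap.  Cell `pub-ymgap` (HUMAN RULING D-0062), Track A node N06 [B9], N06-ASSIGNMENT v1 bundle F6 (rows 18–19), seat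
`pub-ymgap-dag-n06-k` (gen 8), 2026-08-27.
-/
namespace Literature.MathematicalPhysics.QuantumFieldTheory.Balaban1983to89.B9RWSumsDefinitePinsPairM

open Literature.MathematicalPhysics.QuantumFieldTheory.Balaban1983to89
open Finset B6RandomWalk B9Thm34Ext B9Thm37Whole B9Cor38Whole B9Thm310Whole B9RowSum261Faces B9RowSum261DefiniteFaces
open B9Ineq349Whole B9RWSums343to347Whole B9PinMembersKLevelV1 B9GeoLemma21KLevelV1 B9RWSums347DefiniteFaces
open B9Thm37GlueCor36 B9Thm37Glue B9RWSums346Schur B9RWSums343Holder B9RWSums343HolderGp B9RWSums346Lap B9RWSums344Input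
open B9RWSums344InputGp B9RWSums346Two B9RWSums346TwoGp B11SectG B9RWSumsCompleteGeo9Y B9RWSumsDefinitePins
open B9CoRealizesRel B9RWSumsReadsRel B9RWSumsReadsNbr B9RWSumsAllBlocksNbr B9RWSumsCompleteGeo9YNbr
open B9RWSums346SecondDiff B9RWSums346SecondDiffGp B9RWSumsAllBlocksPair B9RWSumsCompleteGeo9YPair
open B9RWSumsDefinitePinsNbr B9RWSumsDefinitePinsPair B9RWSums346MixedPair B9RWSums344InputFam B9RWSums344InputPair B9RWSumsAllBlocksPairM
open B9RWSumsCompleteGeo9YPairM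

noncomputable section

/-! ## §1 The second-order primitive constants, the enlarged shared constant, and the definite E-letters of the `Pair` face -/

/-- ★ **THE PRIMITIVE CONSTANTS OF THE MIXED-MEMBER LEGS OF ONE SIDE**: the overlap count N_M of the localized legs ∇_ν(h_□G_□h_□)∇\*_μ, their
constant B_M and the factors' constant θ_M (all «constants by choice» feeding the posited schemas `L2MixedLegs…`, `FactorsL2Mixed…`,
`InputLegsPair…`, `FactorsInputPair…`; the second-order records `PairPrims` are the sibling's).
[cite: Balaban1985BackgroundPropagators, Thm 3.1 p.397 («There exist positive constants …») + (3.44)–(3.46) p.398, bookkeeping] -/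
structure MixedPrims where
  NM : ℝ
  BM : ℝ
  θM : ℝ

/-- the signs of the mixed-member primitive constants. [cite: Balaban1985BackgroundPropagators, Thm 3.1 p.397, bookkeeping] -/
def MixedPrims.OK (r : MixedPrims) : Prop := 0 ≤ r.NM ∧ 0 ≤ r.BM ∧ 0 ≤ r.θM

/-- `lowerB_{G′} ≤ B1Y` (twin of the sibling's private lemma). [folklore] -/
private theorem lowerB_le_B1Y_left' (p q : PinPrims) (dp dFp dq dFq : ℕ) (L₀ : ℝ) :
    p.lowerB dp dFp p.N' L₀ ≤ B1Y p q dp dFp dq dFq L₀ :=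
  (le_max_left _ _).trans (le_max_right _ _)

/-- `lowerB_G ≤ B1Y` (twin of the sibling's private lemma). [folklore] -/
private theorem lowerB_le_B1Y_right' (p q : PinPrims) (dp dFp dq dFq : ℕ) (L₀ : ℝ) :
    q.lowerB dq dFq q.NF L₀ ≤ B1Y p q dp dFp dq dFq L₀ :=
  (le_max_right _ _).trans (le_max_right _ _)

/-- `C ≤ pinLowerB …`. [folklore] -/
private theorem le_pinLowerB₁' (C cF lapC twoC L₀ : ℝ) : C ≤ pinLowerB C cF lapC twoC L₀ :=
  (le_max_left _ _).trans ((le_max_left _ _).trans ((le_max_left _ _).trans (le_max_left _ _)))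

/-- `C·L₀ ≤ pinLowerB …`. [folklore] -/
private theorem le_pinLowerB₂' (C cF lapC twoC L₀ : ℝ) : C * L₀ ≤ pinLowerB C cF lapC twoC L₀ :=
  (le_max_right _ _).trans ((le_max_left _ _).trans ((le_max_left _ _).trans (le_max_left _ _)))

/-- `C·c_F·L₀⁴ ≤ pinLowerB …`. [folklore] -/
private theorem le_pinLowerB₃' (C cF lapC twoC L₀ : ℝ) : C * cF * L₀ ^ (4 : ℝ) ≤ pinLowerB C cF lapC twoC L₀ :=
  (le_max_right _ _).trans ((le_max_left _ _).trans (le_max_left _ _))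

/-- `√(C·lapC)·L₀ ≤ pinLowerB …`. [folklore] -/
private theorem le_pinLowerB₄' (C cF lapC twoC L₀ : ℝ) : Real.sqrt (C * lapC) * L₀ ≤ pinLowerB C cF lapC twoC L₀ :=
  (le_max_right _ _).trans (le_max_left _ _)

/-- **THE ENLARGED SHARED CONSTANT OF THE `PairM` FACE**: `B1Pair` plus `NQ·(mixedConst_{G′} + mixedConst_G)` — dominates every operator-level
constant of both sides including the second-order and mixed ones. [cite: Balaban1985BackgroundPropagators, Thm 3.1 p.397, bookkeeping] -/
def B1PairM (p q : PinPrims) (p3 q3 : PairPrims) (pM qM : MixedPrims) (NQ : ℝ) (dp dFp dq dFq : ℕ) (L₀ : ℝ) : ℝ :=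
  B1Pair p q p3 q3 NQ dp dFp dq dFq L₀ +
    NQ * (mixedConst dp p.δ₀ p.α pM.NM pM.BM p.N' pM.θM (p.C dp) L₀ + mixedConst dq q.δ₀ q.α qM.NM qM.BM q.NF qM.θM (q.C dq) L₀)

section StageY

variable {d ℓ : ℕ} {hd : 1 ≤ d + 1} {hL : Odd (ℓ + 1) ∧ 1 < ℓ + 1} {b₀ b₁ : ℝ} {Mstar : ℕ}
variable [∀ x : MemberY d ℓ hd hL b₀ b₁ Mstar, Fintype (geo9Y x).Site]
  [∀ x : MemberY d ℓ hd hL b₀ b₁ Mstar, DecidableEq (geo9Y x).Site]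
variable {c35 : ℝ} {bg : MemberY d ℓ hd hL b₀ b₁ Mstar → B9.Backgrounds}

/-- ★ **THE DEFINITE E-LETTER OF THEOREM 3.7 ∕ COROLLARY 3.8 AT A MEMBER FOR THE `PairM` FACE**: `E37YNbr` with the shared constant enlarged to
`B1PairM` (the second-order and mixed constants of both sides absorbed) and everything scaled by `nbrScale m mN Cev (ℓ+1) (delta1Y p q)`; δ₁ unchanged.
OURS (a pin target for `(ops x).E37`). [cite: Balaban1985BackgroundPropagators, Thm 3.7 (3.90) p.409 + Cor. 3.8 (3.93)–(3.94) p.410 + Thm 3.1 (3.42)–(3.47) pp.397–398] -/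
def E37YPairM (m mN : ℕ) (Cev NQ : ℝ) (p q : PinPrims) (p3 q3 : PairPrims) (pM qM : MixedPrims) {x : MemberY d ℓ hd hL b₀ b₁ Mstar} {X Y ι : Type} (𝔬 : Ops (geo9Y x) (bg x) X Y ι)
    (rd : WalkReading (geo9Y x) (bg x) X ι) (H : Prop) (K : B9.KernelFamily (geo9Y x) (bg x)) :
    B9.RWExpansion (geo9Y x) (bg x) :=
  E37AllOfOps
    (W38OfOps 𝔬 rd 1 H (p.C (exp261 (@geo9Y d ℓ hd hL b₀ b₁ Mstar) p.δ₀ p.α)) ((1 - 2 * p.α) * p.δ₀))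
    𝔬 1 H (p.C (exp261 (@geo9Y d ℓ hd hL b₀ b₁ Mstar) p.δ₀ p.α)) ((1 - 2 * p.α) * p.δ₀) K
    (nbrScale m mN Cev ((ℓ + 1 : ℕ) : ℝ) (delta1Y p q) * B1PairM p q p3 q3 pM qM NQ (exp261 (@geo9Y d ℓ hd hL b₀ b₁ Mstar) p.δ₀ p.α)
      (exp261 (@geo9Y d ℓ hd hL b₀ b₁ Mstar) ((1 - 2 * p.α) * p.δ₀) (1 - p.αF))
      (exp261 (@geo9Y d ℓ hd hL b₀ b₁ Mstar) q.δ₀ q.α)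
      (exp261 (@geo9Y d ℓ hd hL b₀ b₁ Mstar) ((1 - 2 * q.α) * q.δ₀) (1 - q.αF)) ((ℓ + 1 : ℕ) : ℝ))
    (delta1Y p q)
    (fun β => nbrScale m mN Cev ((ℓ + 1 : ℕ) : ℝ) (delta1Y p q) *
      BbetaY p q (exp261 (@geo9Y d ℓ hd hL b₀ b₁ Mstar) p.δ₀ p.α) (exp261 (@geo9Y d ℓ hd hL b₀ b₁ Mstar) q.δ₀ q.α) β)
    (fun ε => nbrScale m mN Cev ((ℓ + 1 : ℕ) : ℝ) (delta1Y p q) *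
      BepsY p q (exp261 (@geo9Y d ℓ hd hL b₀ b₁ Mstar) p.δ₀ p.α) (exp261 (@geo9Y d ℓ hd hL b₀ b₁ Mstar) q.δ₀ q.α)
        ((ℓ + 1 : ℕ) : ℝ) ε)
    (fun ε β => nbrScale m mN Cev ((ℓ + 1 : ℕ) : ℝ) (delta1Y p q) *
      BepsbetaY p q (exp261 (@geo9Y d ℓ hd hL b₀ b₁ Mstar) p.δ₀ p.α) (exp261 (@geo9Y d ℓ hd hL b₀ b₁ Mstar) q.δ₀ q.α)
        ((ℓ + 1 : ℕ) : ℝ) ε β)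

/-- ★ **THE DEFINITE E-LETTER OF THEOREM 3.10 AT A MEMBER FOR THE `PairM` FACE**: `E310YNbr` with the shared constant `B1PairM`, scaled by
`nbrScale m mN Cev (ℓ+1) (delta1Y p q)`.  OURS (a pin target for `(ops x).E310`). [cite: Balaban1985BackgroundPropagators, Thm 3.10 (3.107)–(3.108) pp.415–416 + Thm 3.3 p.399] -/
def E310YPairM (m mN : ℕ) (Cev NQ : ℝ) (p q : PinPrims) (p3 q3 : PairPrims) (pM qM : MixedPrims) {x : MemberY d ℓ hd hL b₀ b₁ Mstar} {X Y ι A : Type}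
    (𝔬 : Ops310 (geo9Y x) (bg x) X Y ι A) (rd : WalkReading310 (geo9Y x) (bg x) X ι A) (H : Prop)
    (K : B9.KernelFamily (geo9Y x) (bg x)) : B9.RWExpansion (geo9Y x) (bg x) :=
  W310OfOps 𝔬 rd
    (ConvAll3107 𝔬 1 H (q.C (exp261 (@geo9Y d ℓ hd hL b₀ b₁ Mstar) q.δ₀ q.α)) ((1 - 2 * q.α) * q.δ₀) K
      (nbrScale m mN Cev ((ℓ + 1 : ℕ) : ℝ) (delta1Y p q) * B1PairM p q p3 q3 pM qM NQ (exp261 (@geo9Y d ℓ hd hL b₀ b₁ Mstar) p.δ₀ p.α)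
        (exp261 (@geo9Y d ℓ hd hL b₀ b₁ Mstar) ((1 - 2 * p.α) * p.δ₀) (1 - p.αF))
        (exp261 (@geo9Y d ℓ hd hL b₀ b₁ Mstar) q.δ₀ q.α)
        (exp261 (@geo9Y d ℓ hd hL b₀ b₁ Mstar) ((1 - 2 * q.α) * q.δ₀) (1 - q.αF)) ((ℓ + 1 : ℕ) : ℝ))
      (delta1Y p q)
      (fun β => nbrScale m mN Cev ((ℓ + 1 : ℕ) : ℝ) (delta1Y p q) *
        BbetaY p q (exp261 (@geo9Y d ℓ hd hL b₀ b₁ Mstar) p.δ₀ p.α) (exp261 (@geo9Y d ℓ hd hL b₀ b₁ Mstar) q.δ₀ q.α) β)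
      (fun ε => nbrScale m mN Cev ((ℓ + 1 : ℕ) : ℝ) (delta1Y p q) *
        BepsY p q (exp261 (@geo9Y d ℓ hd hL b₀ b₁ Mstar) p.δ₀ p.α) (exp261 (@geo9Y d ℓ hd hL b₀ b₁ Mstar) q.δ₀ q.α)
          ((ℓ + 1 : ℕ) : ℝ) ε)
      (fun ε β => nbrScale m mN Cev ((ℓ + 1 : ℕ) : ℝ) (delta1Y p q) *
        BepsbetaY p q (exp261 (@geo9Y d ℓ hd hL b₀ b₁ Mstar) p.δ₀ p.α) (exp261 (@geo9Y d ℓ hd hL b₀ b₁ Mstar) q.δ₀ q.α)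
          ((ℓ + 1 : ℕ) : ℝ) ε β))

/-! ## §2 ★★★ Rows 13 ∕ 18 ∕ 19 as ONE face at the definite `Pair` E-letters -/

set_option maxHeartbeats 400000 in
-- build stability: the v3.1 twin needed the same guard in the tree (ops-buildfix-2, p516056)
/-- ★★★ **ROWS 13 ∕ 18 ∕ 19 OF THE N06 CENSUS AT def-Y's MEMBERS WITH DEFINITE EXPANSION DATA, NEIGHBOURHOOD-SITED CO-READINGS, AND THE
PRINTED SECOND-ORDER L² MEMBERS AS DIRECTION-PAIR FAMILIES** — the `Pair` form of `B9RWSumsDefinitePinsNbr.rows131819_definite_geo9Y_nbr`: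
Theorem 3.7 ∧ Corollary 3.8 at `E37YPair m mN Cev NQ p q p3 q3`, Theorem 3.10 at `E310YPair …` and the summation leaf for the pair, from the sign
records `p q` (sibling's) and `p3 q3` (second-order legs and factors), the direction count bound `NQ`, ONE block equivalence `Rel x` with class
multiplicity and saturation, the neighbourhood count, the evaluation constant, the direction letters `𝔡 𝔡A`, and the OPERATOR-LEVEL inputs of
both sides (the Laplacian legs replaced by `L2SecondLegs… ∧ FactorsL2Second… ∧ DirTranspose…`; `hl4 hl5 hlA4 hlA5` read the `familyOp`
packages of ∇∇G′, G′∇\*∇\*, ∇∇G, G∇\*∇\*, `hl3 hlA3` the mixed members ∇G′∇\*, ∇G∇\* on the PAIR FAMILY `Dd ∘ G ∘ Dsd` (v4), `hIR hIRA` the (3.44)∕(3.45)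
members on the same family through `InputReadsFam` with sliced X-probes — def-Y's K-index order).  Inside: `thm37_cor38_complete_geo9Y_pairM` ∕
`thm310_complete_geo9Y_pairM` at B₁ := `nbrScale … · B1PairM …`,
δ₁ := `delta1Y p q`, the three Hölder∕input families scaled by `nbrScale …`, and `rwSumsYieldIneqs_allPins`.  Nothing of print asserted; NOT a node
discharge.
[cite: Balaban1985BackgroundPropagators, Thm 3.7 p.409 + Cor. 3.8 p.410 + Thm 3.10 pp.415–416 + Thm 3.7 ⇒ Thm 3.1 p.410 + Thm 3.10 ⇒ Thm 3.3 p.416 + Cor. 3.6 p.408; Balaban1984PropagatorsII, (2.51)–(2.52) p.232 + Lemma 2.1 pp.233–234] -/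
theorem rows131819_definite_geo9Y_pairM {X Y ι PX PY Q XA YA ιA AA PXA PYA QA : MemberY d ℓ hd hL b₀ b₁ Mstar → Type}
    [∀ x, Fintype (X x)] [∀ x, DecidableEq (X x)] [∀ x, Fintype (Y x)] [∀ x, DecidableEq (Y x)] [∀ x, Fintype (ι x)]
    [∀ x, Fintype (PX x)] [∀ x, DecidableEq (PX x)] [∀ x, Fintype (PY x)] [∀ x, DecidableEq (PY x)]
    [∀ x, Fintype (XA x)] [∀ x, DecidableEq (XA x)] [∀ x, Fintype (YA x)] [∀ x, DecidableEq (YA x)] [∀ x, Fintype (ιA x)]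
    [∀ x, Fintype (AA x)] [∀ x, Fintype (PXA x)] [∀ x, DecidableEq (PXA x)] [∀ x, Fintype (PYA x)] [∀ x, DecidableEq (PYA x)]
    [∀ x, Fintype (Q x)] [∀ x, Fintype (QA x)]
    (p q : PinPrims) (hp : p.OK) (hq : q.OK) (p3 q3 : PairPrims) (hp3 : p3.OK) (hq3 : q3.OK) (pM qM : MixedPrims) (hpM : pM.OK)
    (hqM : qM.OK) (NQ : ℝ) (hNQ0 : 0 ≤ NQ)
    (hc : 0 < c35) (H : MemberY d ℓ hd hL b₀ b₁ Mstar → Prop)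
    -- the block equivalence of the instance («same carrier block»), its multiplicity and saturation
    (Rel : ∀ x : MemberY d ℓ hd hL b₀ b₁ Mstar, (geo9Y x).Site → (geo9Y x).Site → Prop) [∀ x, DecidableRel (Rel x)] (m mN : ℕ)
    (Cev : ℝ) (hCev : 0 ≤ Cev)
    (hRlen : ∀ x (a a' : (geo9Y x).Site), Rel x a a' → (geo9Y x).len a = (geo9Y x).len a')
    (hRd₁ : ∀ x (a a' b : (geo9Y x).Site), Rel x a a' → (geo9Y x).dist a b = (geo9Y x).dist a' b)
    (hRd₂ : ∀ x (a b b' : (geo9Y x).Site), Rel x b b' → (geo9Y x).dist a b = (geo9Y x).dist a b')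
    (hmult : ∀ x (y' : (geo9Y x).Site), (Finset.univ.filter (fun y'' => Rel x y'' y')).card ≤ m)
    (hnbr : ∀ (x : MemberY d ℓ hd hL b₀ b₁ Mstar) (y : (geo9Y x).Site), (nbr (geo9Y x) 2 y).card ≤ mN)
    -- the G′ side (Theorem 3.7 ∕ Corollary 3.8)
    (𝔬 : ∀ x : MemberY d ℓ hd hL b₀ b₁ Mstar, Ops (geo9Y x) (bg x) (X x) (Y x) (ι x))
    (rd : ∀ x : MemberY d ℓ hd hL b₀ b₁ Mstar, WalkReading (geo9Y x) (bg x) (X x) (ι x))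
    (𝔭 : ∀ x : MemberY d ℓ hd hL b₀ b₁ Mstar, HolderProbes (geo9Y x) (bg x) (X x) (Y x) (PX x) (PY x))
    (𝔡 : ∀ x : MemberY d ℓ hd hL b₀ b₁ Mstar, DirOps37 (𝔬 x) (Q x))
    (bHX : ∀ x : MemberY d ℓ hd hL b₀ b₁ Mstar, ℝ → BlockNorm (toB6 (geo9Y x) 1 (H x)) (X x → ℝ))
    (K : ∀ x : MemberY d ℓ hd hL b₀ b₁ Mstar, B9.KernelFamily (geo9Y x) (bg x))
    (ev : ∀ x : MemberY d ℓ hd hL b₀ b₁ Mstar, (geo9Y x).Loc → X x → ℝ)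
    (evY : ∀ x : MemberY d ℓ hd hL b₀ b₁ Mstar, (geo9Y x).Loc → Y x → ℝ)
    (κ : MemberY d ℓ hd hL b₀ b₁ Mstar → Sizes) (SH S3 SI SM : ∀ x : MemberY d ℓ hd hL b₀ b₁ Mstar, ι x → Finset (geo9Y x).Site)
    (hst : ∀ x, StaticOK (𝔬 x) p.ρ p.Nc p.N' p.Cℓ (κ x)) (hκ : ∀ x, (κ x).Bounded p.Kc p.θ₀ p.Cℓ (geo9Y x).M)
    (hrd : ∀ x, (rd x).OK (𝔬 x).blk) (hloc : ∀ x, Locality (𝔬 x) (rd x))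
    (h36 : ∀ x, p.M₁ ≤ (geo9Y x).M → ∀ α₀ : ℝ, 0 < α₀ → c35 * (geo9Y x).M * α₀ ≤ p.a₁ →
      ∀ U : (bg x).Cfg, (bg x).Reg335 c35 α₀ U → Local342 (𝔬 x) 1 (H x) p.B₀ p.δ₀ U ∧ Identities (𝔬 x) 1 (H x) U)
    (h36H : ∀ x, p.M₁ ≤ (geo9Y x).M → ∀ α₀ : ℝ, 0 < α₀ → c35 * (geo9Y x).M * α₀ ≤ p.a₁ →
      ∀ U : (bg x).Cfg, (bg x).Reg335 c35 α₀ U →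
        HolderLegs37 (𝔬 x) (𝔭 x) 1 (H x) (SH x) p.Bl p.δ₀ U ∧ HolderV37 (𝔬 x) (𝔭 x) 1 (H x) p.Bt p.δ₀ U ∧
          (L2SecondLegs37 (𝔬 x) (𝔡 x) 1 (H x) (S3 x) p3.B3 p.δ₀ U ∧ FactorsL2Second37 (𝔬 x) (𝔡 x) 1 (H x) p3.θ3 p.δ₀ U ∧
            DirTranspose37 (𝔬 x) (𝔡 x) U) ∧
            (InputLegsPair37 (𝔬 x) (𝔡 x) (𝔭 x) 1 (H x) (bHX x) (SI x) p.BI p.BI2 p.δ₀ U ∧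
              FactorsInputPair37 (𝔬 x) (𝔡 x) 1 (H x) (bHX x) p.θI p.δ₀ U ∧ DirSupHolder37 (𝔬 x) (𝔡 x) (𝔭 x) 1 (H x) U) ∧
              (L2MixedLegs37 (𝔬 x) (𝔡 x) 1 (H x) (SM x) pM.BM p.δ₀ U ∧ FactorsL2Mixed37 (𝔬 x) (𝔡 x) 1 (H x) pM.θM p.δ₀ U ∧
                DirSup37 (𝔬 x) (𝔡 x) 1 (H x) U))
    (hco0 : ∀ x U, CoRealizesRel (K x) 0 U (Rel x) (𝔬 x).blk (𝔬 x).blk (ev x) ((𝔬 x).Gp U))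
    (hco1 : ∀ x U, CoRealizesRel (K x) 1 U (Rel x) (𝔬 x).blkY (𝔬 x).blk (ev x) ((𝔬 x).D U ∘ₗ (𝔬 x).Gp U))
    (hco2 : ∀ x U, CoRealizesRel (K x) 2 U (Rel x) (𝔬 x).blk (𝔬 x).blkY (evY x) ((𝔬 x).Gp U ∘ₗ (𝔬 x).Dstar U))
    (hco3 : ∀ x U, CoRealizesRel (K x) 3 U (Rel x) (𝔬 x).blk (𝔬 x).blk (ev x) ((𝔬 x).Lap U ∘ₗ (𝔬 x).Gp U))
    (hgl0 : ∀ x U, GlobReads (K x) 0 U (𝔬 x).blk (𝔬 x).blk (ev x) ((𝔬 x).Gp U))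
    (hgl1 : ∀ x U, GlobReads (K x) 1 U (𝔬 x).blkY (𝔬 x).blk (ev x) ((𝔬 x).D U ∘ₗ (𝔬 x).Gp U))
    (hgl2 : ∀ x U, GlobReads (K x) 2 U (𝔬 x).blk (𝔬 x).blkY (evY x) ((𝔬 x).Gp U ∘ₗ (𝔬 x).Dstar U))
    (hgl3 : ∀ x U, GlobReads (K x) 3 U (𝔬 x).blk (𝔬 x).blk (ev x) ((𝔬 x).Lap U ∘ₗ (𝔬 x).Gp U))
    (hl0 : ∀ x U, L2ReadsNbr (R := 1) (H := H x) (K x) 0 U (Rel x) 2 Cev (𝔬 x).blk (𝔬 x).blk (ev x) ((𝔬 x).Gp U))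
    (hl1 : ∀ x U, L2ReadsNbr (R := 1) (H := H x) (K x) 1 U (Rel x) 2 Cev (𝔬 x).blkY (𝔬 x).blk (ev x) ((𝔬 x).D U ∘ₗ (𝔬 x).Gp U))
    (hl2 : ∀ x U, L2ReadsNbr (R := 1) (H := H x) (K x) 2 U (Rel x) 2 Cev (𝔬 x).blk (𝔬 x).blkY (evY x) ((𝔬 x).Gp U ∘ₗ (𝔬 x).Dstar U))
    (hl3 : ∀ x U, L2ReadsNbr (R := 1) (H := H x) (K x) 3 U (Rel x) 2 Cev ((𝔬 x).blk ∘ Prod.fst) (𝔬 x).blk (ev x)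
      (familyOp fun p : Q x × Q x => (𝔡 x).Dd U p.1 ∘ₗ ((𝔬 x).Gp U ∘ₗ (𝔡 x).Dsd U p.2)))
    (hl4 : ∀ x U, L2ReadsNbr (R := 1) (H := H x) (K x) 4 U (Rel x) 2 Cev ((𝔬 x).blk ∘ Prod.fst) (𝔬 x).blk (ev x)
      (familyOp fun p : Q x × Q x => ((𝔡 x).Dd U p.1 ∘ₗ (𝔡 x).Dd U p.2) ∘ₗ (𝔬 x).Gp U))
    (hl5 : ∀ x U, L2ReadsNbr (R := 1) (H := H x) (K x) 5 U (Rel x) 2 Cev ((𝔬 x).blk ∘ Prod.fst) (𝔬 x).blk (ev x)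
      (familyOp fun p : Q x × Q x => (𝔬 x).Gp U ∘ₗ ((𝔡 x).Dsd U p.1 ∘ₗ (𝔡 x).Dsd U p.2)))
    (hH1 : ∀ x U, H1ReadsNbr (K x) U (𝔭 x) (Rel x) 2 (𝔬 x).blk (𝔬 x).blkY (ev x) (evY x) ((𝔬 x).D U ∘ₗ (𝔬 x).Gp U)
      ((𝔬 x).Gp U ∘ₗ (𝔬 x).Dstar U))
    (hIR : ∀ x U, InputReadsFam (K x) U (bHX x) 2 ((𝔬 x).blk ∘ Prod.fst) ((𝔭 x).blkPX ∘ Prod.fst)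
      (fun β => sliceProbe ((𝔭 x).ΦX U β)) (ev x)
      (familyOp fun p : Q x × Q x => (𝔡 x).Dd U p.1 ∘ₗ ((𝔬 x).Gp U ∘ₗ (𝔡 x).Dsd U p.2)))
    (hsym : ∀ x, p.M₁ ≤ (geo9Y x).M → ∀ α₀ : ℝ, 0 < α₀ → c35 * (geo9Y x).M * α₀ ≤ p.a₁ →
      ∀ U : (bg x).Cfg, (bg x).Reg335 c35 α₀ U → IsTransposePair ((𝔬 x).Gp U) ((𝔬 x).Gp U))
    (htr : ∀ x, p.M₁ ≤ (geo9Y x).M → ∀ α₀ : ℝ, 0 < α₀ → c35 * (geo9Y x).M * α₀ ≤ p.a₁ →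
      ∀ U : (bg x).Cfg, (bg x).Reg335 c35 α₀ U → IsTransposePair ((𝔬 x).D U ∘ₗ (𝔬 x).Gp U) ((𝔬 x).Gp U ∘ₗ (𝔬 x).Dstar U))
    (hcntH : ∀ x (a : (geo9Y x).Site), (∑ c, if a ∈ SH x c then (1 : ℝ) else 0) ≤ p.NH)
    (hcnt3 : ∀ x (a : (geo9Y x).Site), (∑ c, if a ∈ S3 x c then (1 : ℝ) else 0) ≤ p3.N3)
    (hNQ : ∀ x, (Fintype.card (Q x) : ℝ) ≤ NQ)
    (hcntI : ∀ x (a : (geo9Y x).Site), (∑ c, if a ∈ SI x c then (1 : ℝ) else 0) ≤ p.NI)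
    (hcntM : ∀ x (a : (geo9Y x).Site), (∑ c, if a ∈ SM x c then (1 : ℝ) else 0) ≤ pM.NM)
    -- the G side (Theorem 3.10)
    (𝔬A : ∀ x : MemberY d ℓ hd hL b₀ b₁ Mstar, Ops310 (geo9Y x) (bg x) (XA x) (YA x) (ιA x) (AA x))
    (rdA : ∀ x : MemberY d ℓ hd hL b₀ b₁ Mstar, WalkReading310 (geo9Y x) (bg x) (XA x) (ιA x) (AA x))
    (𝔭A : ∀ x : MemberY d ℓ hd hL b₀ b₁ Mstar, HolderProbes (geo9Y x) (bg x) (XA x) (YA x) (PXA x) (PYA x))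
    (𝔡A : ∀ x : MemberY d ℓ hd hL b₀ b₁ Mstar, DirOps310 (𝔬A x) (QA x))
    (bHXA : ∀ x : MemberY d ℓ hd hL b₀ b₁ Mstar, ℝ → BlockNorm (toB6 (geo9Y x) 1 (H x)) (XA x → ℝ))
    (KA : ∀ x : MemberY d ℓ hd hL b₀ b₁ Mstar, B9.KernelFamily (geo9Y x) (bg x))
    (evA : ∀ x : MemberY d ℓ hd hL b₀ b₁ Mstar, (geo9Y x).Loc → XA x → ℝ)
    (evYA : ∀ x : MemberY d ℓ hd hL b₀ b₁ Mstar, (geo9Y x).Loc → YA x → ℝ)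
    (κA : MemberY d ℓ hd hL b₀ b₁ Mstar → Sizes310)
    (SHA S3A SIA SMA : ∀ x : MemberY d ℓ hd hL b₀ b₁ Mstar, ιA x → Finset (geo9Y x).Site)
    (hstA : ∀ x, StaticOK310 (𝔬A x) q.ρ q.Nc q.N' q.NF q.Cℓ (κA x)) (hκA : ∀ x, (κA x).Bounded q.Kc)
    (hrdA : ∀ x, (rdA x).OK (𝔬A x).blk) (hlocA : ∀ x, Locality310 (𝔬A x) (rdA x))
    (h36A : ∀ x, q.M₁ ≤ (geo9Y x).M → ∀ α₀ : ℝ, 0 < α₀ → c35 * (geo9Y x).M * α₀ ≤ q.a₁ →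
      ∀ U : (bg x).Cfg, (bg x).Reg335 c35 α₀ U →
        Local342G (𝔬A x) 1 (H x) q.B₀ q.δ₀ U ∧ B9Thm310Whole.Factors389 (𝔬A x) 1 (H x) q.θ₀ q.δ₀ U ∧
          Identities310 (𝔬A x) 1 (H x) U)
    (h36HA : ∀ x, q.M₁ ≤ (geo9Y x).M → ∀ α₀ : ℝ, 0 < α₀ → c35 * (geo9Y x).M * α₀ ≤ q.a₁ →
      ∀ U : (bg x).Cfg, (bg x).Reg335 c35 α₀ U →
        HolderLegs310 (𝔬A x) (𝔭A x) 1 (H x) (SHA x) q.Bl q.δ₀ U ∧ FactorsHolder310 (𝔬A x) (𝔭A x) 1 (H x) q.Bt q.δ₀ U ∧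
          (L2SecondLegs310 (𝔬A x) (𝔡A x) 1 (H x) (S3A x) q3.B3 q.δ₀ U ∧ FactorsL2Second310 (𝔬A x) (𝔡A x) 1 (H x) q3.θ3 q.δ₀ U ∧
            DirTranspose310 (𝔬A x) (𝔡A x) U) ∧
            (InputLegsPair310 (𝔬A x) (𝔡A x) (𝔭A x) 1 (H x) (bHXA x) (SIA x) q.BI q.BI2 q.δ₀ U ∧
              FactorsInputPair310 (𝔬A x) (𝔡A x) 1 (H x) (bHXA x) q.θI q.δ₀ U ∧ DirSupHolder310 (𝔬A x) (𝔡A x) (𝔭A x) 1 (H x) U) ∧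
              (L2MixedLegs310 (𝔬A x) (𝔡A x) 1 (H x) (SMA x) qM.BM q.δ₀ U ∧ FactorsL2Mixed310 (𝔬A x) (𝔡A x) 1 (H x) qM.θM q.δ₀ U ∧
                DirSup310 (𝔬A x) (𝔡A x) 1 (H x) U))
    (hcoA0 : ∀ x U, CoRealizesRel (KA x) 0 U (Rel x) (𝔬A x).blk (𝔬A x).blk (evA x) ((𝔬A x).G U))
    (hcoA1 : ∀ x U, CoRealizesRel (KA x) 1 U (Rel x) (𝔬A x).blkY (𝔬A x).blk (evA x) ((𝔬A x).D U ∘ₗ (𝔬A x).G U))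
    (hcoA2 : ∀ x U, CoRealizesRel (KA x) 2 U (Rel x) (𝔬A x).blk (𝔬A x).blkY (evYA x) ((𝔬A x).G U ∘ₗ (𝔬A x).Dstar U))
    (hcoA3 : ∀ x U, CoRealizesRel (KA x) 3 U (Rel x) (𝔬A x).blk (𝔬A x).blk (evA x) ((𝔬A x).Lap U ∘ₗ (𝔬A x).G U))
    (hglA0 : ∀ x U, GlobReads (KA x) 0 U (𝔬A x).blk (𝔬A x).blk (evA x) ((𝔬A x).G U))
    (hglA1 : ∀ x U, GlobReads (KA x) 1 U (𝔬A x).blkY (𝔬A x).blk (evA x) ((𝔬A x).D U ∘ₗ (𝔬A x).G U))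
    (hglA2 : ∀ x U, GlobReads (KA x) 2 U (𝔬A x).blk (𝔬A x).blkY (evYA x) ((𝔬A x).G U ∘ₗ (𝔬A x).Dstar U))
    (hglA3 : ∀ x U, GlobReads (KA x) 3 U (𝔬A x).blk (𝔬A x).blk (evA x) ((𝔬A x).Lap U ∘ₗ (𝔬A x).G U))
    (hlA0 : ∀ x U, L2ReadsNbr (R := 1) (H := H x) (KA x) 0 U (Rel x) 2 Cev (𝔬A x).blk (𝔬A x).blk (evA x) ((𝔬A x).G U))
    (hlA1 : ∀ x U, L2ReadsNbr (R := 1) (H := H x) (KA x) 1 U (Rel x) 2 Cev (𝔬A x).blkY (𝔬A x).blk (evA x) ((𝔬A x).D U ∘ₗ (𝔬A x).G U))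
    (hlA2 : ∀ x U, L2ReadsNbr (R := 1) (H := H x) (KA x) 2 U (Rel x) 2 Cev (𝔬A x).blk (𝔬A x).blkY (evYA x) ((𝔬A x).G U ∘ₗ (𝔬A x).Dstar U))
    (hlA3 : ∀ x U, L2ReadsNbr (R := 1) (H := H x) (KA x) 3 U (Rel x) 2 Cev ((𝔬A x).blk ∘ Prod.fst) (𝔬A x).blk (evA x)
      (familyOp fun p : QA x × QA x => (𝔡A x).Dd U p.1 ∘ₗ ((𝔬A x).G U ∘ₗ (𝔡A x).Dsd U p.2)))
    (hlA4 : ∀ x U, L2ReadsNbr (R := 1) (H := H x) (KA x) 4 U (Rel x) 2 Cev ((𝔬A x).blk ∘ Prod.fst) (𝔬A x).blk (evA x)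
      (familyOp fun p : QA x × QA x => ((𝔡A x).Dd U p.1 ∘ₗ (𝔡A x).Dd U p.2) ∘ₗ (𝔬A x).G U))
    (hlA5 : ∀ x U, L2ReadsNbr (R := 1) (H := H x) (KA x) 5 U (Rel x) 2 Cev ((𝔬A x).blk ∘ Prod.fst) (𝔬A x).blk (evA x)
      (familyOp fun p : QA x × QA x => (𝔬A x).G U ∘ₗ ((𝔡A x).Dsd U p.1 ∘ₗ (𝔡A x).Dsd U p.2)))
    (hH1A : ∀ x U, H1ReadsNbr (KA x) U (𝔭A x) (Rel x) 2 (𝔬A x).blk (𝔬A x).blkY (evA x) (evYA x) ((𝔬A x).D U ∘ₗ (𝔬A x).G U)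
      ((𝔬A x).G U ∘ₗ (𝔬A x).Dstar U))
    (hIRA : ∀ x U, InputReadsFam (KA x) U (bHXA x) 2 ((𝔬A x).blk ∘ Prod.fst) ((𝔭A x).blkPX ∘ Prod.fst)
      (fun β => sliceProbe ((𝔭A x).ΦX U β)) (evA x)
      (familyOp fun p : QA x × QA x => (𝔡A x).Dd U p.1 ∘ₗ ((𝔬A x).G U ∘ₗ (𝔡A x).Dsd U p.2)))
    (hsymA : ∀ x, q.M₁ ≤ (geo9Y x).M → ∀ α₀ : ℝ, 0 < α₀ → c35 * (geo9Y x).M * α₀ ≤ q.a₁ →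
      ∀ U : (bg x).Cfg, (bg x).Reg335 c35 α₀ U → IsTransposePair ((𝔬A x).G U) ((𝔬A x).G U))
    (htrA : ∀ x, q.M₁ ≤ (geo9Y x).M → ∀ α₀ : ℝ, 0 < α₀ → c35 * (geo9Y x).M * α₀ ≤ q.a₁ →
      ∀ U : (bg x).Cfg, (bg x).Reg335 c35 α₀ U → IsTransposePair ((𝔬A x).D U ∘ₗ (𝔬A x).G U) ((𝔬A x).G U ∘ₗ (𝔬A x).Dstar U))
    (hcntHA : ∀ x (a : (geo9Y x).Site), (∑ c, if a ∈ SHA x c then (1 : ℝ) else 0) ≤ q.NH)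
    (hcnt3A : ∀ x (a : (geo9Y x).Site), (∑ c, if a ∈ S3A x c then (1 : ℝ) else 0) ≤ q3.N3)
    (hNQA : ∀ x, (Fintype.card (QA x) : ℝ) ≤ NQ)
    (hcntIA : ∀ x (a : (geo9Y x).Site), (∑ c, if a ∈ SIA x c then (1 : ℝ) else 0) ≤ q.NI)
    (hcntMA : ∀ x (a : (geo9Y x).Site), (∑ c, if a ∈ SMA x c then (1 : ℝ) else 0) ≤ qM.NM) :
    B9.Thm37Printed c35 geo9Y bg (fun x => E37YPairM (bg := bg) m mN Cev NQ p q p3 q3 pM qM (𝔬 x) (rd x) (H x) (K x)) ∧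
      B9.Cor38Printed c35 geo9Y bg (fun x => E37YPairM (bg := bg) m mN Cev NQ p q p3 q3 pM qM (𝔬 x) (rd x) (H x) (K x)) ∧
      B9.Thm310Printed c35 geo9Y bg (fun x => E310YPairM (bg := bg) m mN Cev NQ p q p3 q3 pM qM (𝔬A x) (rdA x) (H x) (KA x)) ∧
      B9.RWSumsYieldIneqs geo9Y bg (fun x => E37YPairM (bg := bg) m mN Cev NQ p q p3 q3 pM qM (𝔬 x) (rd x) (H x) (K x))
        (fun x => E310YPairM (bg := bg) m mN Cev NQ p q p3 q3 pM qM (𝔬A x) (rdA x) (H x) (KA x)) K KA := by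
  set dp : ℕ := exp261 (@geo9Y d ℓ hd hL b₀ b₁ Mstar) p.δ₀ p.α with hdp
  set dFp : ℕ := exp261 (@geo9Y d ℓ hd hL b₀ b₁ Mstar) ((1 - 2 * p.α) * p.δ₀) (1 - p.αF) with hdFp
  set dq : ℕ := exp261 (@geo9Y d ℓ hd hL b₀ b₁ Mstar) q.δ₀ q.α with hdq
  set dFq : ℕ := exp261 (@geo9Y d ℓ hd hL b₀ b₁ Mstar) ((1 - 2 * q.α) * q.δ₀) (1 - q.αF) with hdFq
  set L₀ : ℝ := ((ℓ + 1 : ℕ) : ℝ) with hL₀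
  have hL₀0 : 0 ≤ L₀ := by rw [hL₀]; positivity
  have hB1Y : 0 ≤ B1Y p q dp dFp dq dFq L₀ := (B1Y_pos p q dp dFp dq dFq L₀).le
  obtain ⟨hN3p, hB3p, hθ3p⟩ := hp3
  obtain ⟨hN3q, hB3q, hθ3q⟩ := hq3
  have hCp0 : 0 ≤ p.C dp := PinPrims.C_nonneg hp dp
  have hCq0 : 0 ≤ q.C dq := PinPrims.C_nonneg hq dq
  have hscp : 0 ≤ secondConst dp p.δ₀ p.α p3.N3 p3.B3 p.N' p3.θ3 (p.C dp) L₀ := secondConst_nonneg hN3p hB3p hp.N'_nn hθ3p hCp0 hL₀0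
  have hscq : 0 ≤ secondConst dq q.δ₀ q.α q3.N3 q3.B3 q.NF q3.θ3 (q.C dq) L₀ := secondConst_nonneg hN3q hB3q hq.NF_nn hθ3q hCq0 hL₀0
  obtain ⟨hNMp, hBMp, hθMp⟩ := hpM
  obtain ⟨hNMq, hBMq, hθMq⟩ := hqM
  have hmcp : 0 ≤ mixedConst dp p.δ₀ p.α pM.NM pM.BM p.N' pM.θM (p.C dp) L₀ := mixedConst_nonneg hNMp hBMp hp.N'_nn hθMp hCp0 hL₀0
  have hmcq : 0 ≤ mixedConst dq q.δ₀ q.α qM.NM qM.BM q.NF qM.θM (q.C dq) L₀ := mixedConst_nonneg hNMq hBMq hq.NF_nn hθMq hCq0 hL₀0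
  have hB1le₀ : B1Y p q dp dFp dq dFq L₀ ≤ B1Pair p q p3 q3 NQ dp dFp dq dFq L₀ :=
    le_add_of_nonneg_right (mul_nonneg hNQ0 (add_nonneg hscp hscq))
  have hPM : B1Pair p q p3 q3 NQ dp dFp dq dFq L₀ ≤ B1PairM p q p3 q3 pM qM NQ dp dFp dq dFq L₀ :=
    le_add_of_nonneg_right (mul_nonneg hNQ0 (add_nonneg hmcp hmcq))
  have hB1le : B1Y p q dp dFp dq dFq L₀ ≤ B1PairM p q p3 q3 pM qM NQ dp dFp dq dFq L₀ := hB1le₀.trans hPM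
  have hB1P0 : 0 ≤ B1Pair p q p3 q3 NQ dp dFp dq dFq L₀ := hB1Y.trans hB1le₀
  have hBp := (lowerB_le_B1Y_left' p q dp dFp dq dFq L₀).trans hB1le
  have hBq := (lowerB_le_B1Y_right' p q dp dFp dq dFq L₀).trans hB1le
  have hB1 : 0 ≤ B1PairM p q p3 q3 pM qM NQ dp dFp dq dFq L₀ := hB1Y.trans hB1le
  have hB1pos : 0 < B1PairM p q p3 q3 pM qM NQ dp dFp dq dFq L₀ := lt_of_lt_of_le (B1Y_pos p q dp dFp dq dFq L₀) hB1le
  have h35p : NQ * secondConst dp p.δ₀ p.α p3.N3 p3.B3 p.N' p3.θ3 (p.C dp) L₀ ≤ B1PairM p q p3 q3 pM qM NQ dp dFp dq dFq L₀ :=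
    calc NQ * secondConst dp p.δ₀ p.α p3.N3 p3.B3 p.N' p3.θ3 (p.C dp) L₀
        ≤ NQ * secondConst dp p.δ₀ p.α p3.N3 p3.B3 p.N' p3.θ3 (p.C dp) L₀ +
          (B1Y p q dp dFp dq dFq L₀ + NQ * secondConst dq q.δ₀ q.α q3.N3 q3.B3 q.NF q3.θ3 (q.C dq) L₀) :=
          le_add_of_nonneg_right (add_nonneg hB1Y (mul_nonneg hNQ0 hscq))
      _ = B1Pair p q p3 q3 NQ dp dFp dq dFq L₀ := by unfold B1Pair; ring
      _ ≤ B1PairM p q p3 q3 pM qM NQ dp dFp dq dFq L₀ := hPM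
  have h35q : NQ * secondConst dq q.δ₀ q.α q3.N3 q3.B3 q.NF q3.θ3 (q.C dq) L₀ ≤ B1PairM p q p3 q3 pM qM NQ dp dFp dq dFq L₀ :=
    calc NQ * secondConst dq q.δ₀ q.α q3.N3 q3.B3 q.NF q3.θ3 (q.C dq) L₀
        ≤ NQ * secondConst dq q.δ₀ q.α q3.N3 q3.B3 q.NF q3.θ3 (q.C dq) L₀ +
          (B1Y p q dp dFp dq dFq L₀ + NQ * secondConst dp p.δ₀ p.α p3.N3 p3.B3 p.N' p3.θ3 (p.C dp) L₀) :=
          le_add_of_nonneg_right (add_nonneg hB1Y (mul_nonneg hNQ0 hscp))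
      _ = B1Pair p q p3 q3 NQ dp dFp dq dFq L₀ := by unfold B1Pair; ring
      _ ≤ B1PairM p q p3 q3 pM qM NQ dp dFp dq dFq L₀ := hPM
  have hMp : NQ * mixedConst dp p.δ₀ p.α pM.NM pM.BM p.N' pM.θM (p.C dp) L₀ ≤ B1PairM p q p3 q3 pM qM NQ dp dFp dq dFq L₀ :=
    calc NQ * mixedConst dp p.δ₀ p.α pM.NM pM.BM p.N' pM.θM (p.C dp) L₀
        ≤ NQ * mixedConst dp p.δ₀ p.α pM.NM pM.BM p.N' pM.θM (p.C dp) L₀ +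
          (B1Pair p q p3 q3 NQ dp dFp dq dFq L₀ + NQ * mixedConst dq q.δ₀ q.α qM.NM qM.BM q.NF qM.θM (q.C dq) L₀) :=
          le_add_of_nonneg_right (add_nonneg hB1P0 (mul_nonneg hNQ0 hmcq))
      _ = B1PairM p q p3 q3 pM qM NQ dp dFp dq dFq L₀ := by unfold B1PairM; ring
  have hMq : NQ * mixedConst dq q.δ₀ q.α qM.NM qM.BM q.NF qM.θM (q.C dq) L₀ ≤ B1PairM p q p3 q3 pM qM NQ dp dFp dq dFq L₀ :=
    calc NQ * mixedConst dq q.δ₀ q.α qM.NM qM.BM q.NF qM.θM (q.C dq) L₀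
        ≤ NQ * mixedConst dq q.δ₀ q.α qM.NM qM.BM q.NF qM.θM (q.C dq) L₀ +
          (B1Pair p q p3 q3 NQ dp dFp dq dFq L₀ + NQ * mixedConst dp p.δ₀ p.α pM.NM pM.BM p.N' pM.θM (p.C dp) L₀) :=
          le_add_of_nonneg_right (add_nonneg hB1P0 (mul_nonneg hNQ0 hmcp))
      _ = B1PairM p q p3 q3 pM qM NQ dp dFp dq dFq L₀ := by unfold B1PairM; ring
  -- the scale and its order facts
  have hδ1 : 0 < delta1Y p q := delta1Y_pos hp hq
  have he0 : 0 ≤ Real.exp (2 * delta1Y p q) := Real.exp_nonneg _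
  have hL1 : (1 : ℝ) ≤ L₀ := by rw [hL₀]; exact_mod_cast Nat.succ_le_succ (Nat.zero_le ℓ)
  have hm0 : (0 : ℝ) ≤ m := Nat.cast_nonneg m
  obtain ⟨hs1, hsm, hsL2, hsmL, hse, hsLe⟩ := nbrScale_facts m mN hCev hL1 hδ1.le
  set s : ℝ := nbrScale m mN Cev L₀ (delta1Y p q) with hsname
  have hs0 : (0 : ℝ) ≤ s := zero_le_one.trans hs1
  -- the scaled relations: k·X ≤ s·B for 0 ≤ k ≤ s, 0 ≤ X ≤ B; X ≤ s·B for X ≤ B, 0 ≤ B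
  have scK : ∀ {k X B : ℝ}, 0 ≤ k → k ≤ s → 0 ≤ X → X ≤ B → k * X ≤ s * B := fun hk hks hX hXB =>
    mul_le_mul hks hXB hX hs0
  have sc0 : ∀ {X B : ℝ}, X ≤ B → 0 ≤ B → X ≤ s * B := fun hXB hB => hXB.trans (le_mul_of_one_le_left hB hs1)
  have hmLe0 : 0 ≤ (m : ℝ) * L₀ * Real.exp (2 * delta1Y p q) := by positivity
  have hAe0 : 0 ≤ (mN : ℝ) * m * Cev * L₀ ^ 2 * Real.exp (2 * delta1Y p q) := by positivity
  have hLe0 : 0 ≤ L₀ * Real.exp (2 * delta1Y p q) := by positivity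
  have hCp : 0 ≤ p.C dp := PinPrims.C_nonneg hp dp
  have hCq : 0 ≤ q.C dq := PinPrims.C_nonneg hq dq
  have hc1p : 0 ≤ B6.c1 dp p.δ₀ p.α := c1_nonneg _ _ _
  have hc1q : 0 ≤ B6.c1 dq q.δ₀ q.α := c1_nonneg _ _ _
  have hhold_p : ∀ β, 0 ≤ β → β < 1 → 0 ≤ holderConst dp p.δ₀ p.α p.NH p.N' (p.C dp) (p.Bl β) (p.Bt β) := by
    intro β h0 h1
    have := hp.NH_nn; have := hp.N'_nn; have := hp.Bl_nn β h0 h1; have := hp.Bt_nn β h0 h1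
    unfold holderConst; positivity
  have hhold_q : ∀ β, 0 ≤ β → β < 1 → 0 ≤ holderConst dq q.δ₀ q.α q.NH q.NF (q.C dq) (q.Bl β) (q.Bt β) := by
    intro β h0 h1
    have := hq.NH_nn; have := hq.NF_nn; have := hq.Bl_nn β h0 h1; have := hq.Bt_nn β h0 h1
    unfold holderConst; positivity
  have hin44_p : ∀ ε, 0 < ε → ε ≤ 1 → 0 ≤ inputConst44 dp p.δ₀ p.α p.NI p.N' (p.C dp) L₀ (p.BI ε) (p.θI ε) := by
    intro ε h0 h1
    have := hp.NI_nn; have := hp.N'_nn; have := hp.BI_nn ε h0 h1; have := hp.θI_nn ε h0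
    unfold inputConst44; positivity
  have hin44_q : ∀ ε, 0 < ε → ε ≤ 1 → 0 ≤ inputConst44 dq q.δ₀ q.α q.NI q.NF (q.C dq) L₀ (q.BI ε) (q.θI ε) := by
    intro ε h0 h1
    have := hq.NI_nn; have := hq.NF_nn; have := hq.BI_nn ε h0 h1; have := hq.θI_nn ε h0
    unfold inputConst44; positivity
  have hin45_p : ∀ ε β, 0 < ε → ε ≤ 1 → 0 ≤ β → β < 1 →
      0 ≤ inputConst45 dp p.δ₀ p.α p.NI p.N' L₀ (holderConst dp p.δ₀ p.α p.NH p.N' (p.C dp) (p.Bl β) (p.Bt β)) (p.BI2 ε β)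
        (p.θI (β + ε)) := by
    intro ε β h0 h1 hβ0 hβ1
    have := hp.NI_nn; have := hp.N'_nn; have := hp.BI2_nn ε β h0 h1 hβ0 hβ1; have := hp.θI_nn (β + ε) (by linarith)
    have := hhold_p β hβ0 hβ1
    unfold inputConst45; positivity
  have hin45_q : ∀ ε β, 0 < ε → ε ≤ 1 → 0 ≤ β → β < 1 →
      0 ≤ inputConst45 dq q.δ₀ q.α q.NI q.NF L₀ (holderConst dq q.δ₀ q.α q.NH q.NF (q.C dq) (q.Bl β) (q.Bt β)) (q.BI2 ε β)
        (q.θI (β + ε)) := by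
    intro ε β h0 h1 hβ0 hβ1
    have := hq.NI_nn; have := hq.NF_nn; have := hq.BI2_nn ε β h0 h1 hβ0 hβ1; have := hq.θI_nn (β + ε) (by linarith)
    have := hhold_q β hβ0 hβ1
    unfold inputConst45; positivity
  obtain ⟨t37, c38⟩ := thm37_cor38_complete_geo9Y_pairM (bg := bg) (B₁ := s * B1PairM p q p3 q3 pM qM NQ dp dFp dq dFq L₀)
    (δ₁ := delta1Y p q) (Bβ := fun β => s * BbetaY p q dp dq β) (Bε := fun ε => s * BepsY p q dp dq L₀ ε)
    (Bεβ := fun ε β => s * BepsbetaY p q dp dq L₀ ε β) 𝔬 rd H 𝔭 𝔡 bHX K ev evY Rel m Cev mN hRlen hRd₁ hRd₂ hmult hnbr hCev κ SH S3 SI SM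
    p.Bl p.Bt p.BI p.θI p.BI2 p.α p.ρ p.Nc p.N' p.Cℓ p.Kc p.θ₀ p.B₀ p.δ₀ p.a₁ p.M₁ p.αF p.NH p3.N3 p3.B3 p3.θ3 NQ p.NI pM.NM pM.BM pM.θM hc
    hp.α_pos hp.α_lt hp.Nc_nn hp.N'_nn hp.one_le_Cℓ hp.Kc_nn hp.θ₀_nn hp.B₀_pos hp.δ₀_pos hp.a₁_pos hp.M₁_pos hp.αF_pos
    hp.αF_lt.le hp.NH_nn hN3p hB3p hθ3p hp.NI_nn hNMp hBMp hθMp hst hκ hrd hloc h36 h36H hco0 hco1 hco2 hco3 hgl0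
    hgl1 hgl2 hgl3 hl0 hl1 hl2 hl3 hl4 hl5 hH1 hIR hsym htr hcntH hcnt3 hNQ hcntI hcntM hp.Bl_nn hp.Bt_nn hp.BI_nn hp.BI2_nn
    hp.θI_nn (scK hm0 hsm hCp ((le_pinLowerB₁' _ _ _ _ _).trans hBp))
    (scK hAe0 hsL2 (mul_nonneg hCp hL₀0) ((le_pinLowerB₂' _ _ _ _ _).trans hBp)) hδ1.le (min_le_left _ _)
    (sc0 ((le_pinLowerB₃' _ _ _ _ _).trans hBp) hB1)
    (scK hAe0 hsL2 (mul_nonneg hNQ0 hscp) h35p)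
    (scK hAe0 hsL2 (mul_nonneg hNQ0 hmcp) hMp)
    (fun β h0 h1 => scK hmLe0 hsmL (hhold_p β h0 h1) (le_max_left _ _))
    (fun ε h0 h1 => scK he0 hse (hin44_p ε h0 h1) (le_max_left _ _))
    (fun ε β h0 h1 hβ0 hβ1 => scK hLe0 hsLe (hin45_p ε β h0 h1 hβ0 hβ1) (le_max_left _ _))
  have t310 := thm310_complete_geo9Y_pairM (bg := bg) (B₁ := s * B1PairM p q p3 q3 pM qM NQ dp dFp dq dFq L₀) (δ₁ := delta1Y p q)
    (Bβ := fun β => s * BbetaY p q dp dq β) (Bε := fun ε => s * BepsY p q dp dq L₀ ε)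
    (Bεβ := fun ε β => s * BepsbetaY p q dp dq L₀ ε β) 𝔬A rdA H 𝔭A 𝔡A bHXA KA evA evYA Rel m Cev mN hRlen hRd₁ hRd₂ hmult hnbr hCev
    κA SHA S3A SIA SMA q.Bl q.Bt q.BI q.θI q.BI2 q.α q.ρ q.Nc q.N' q.NF q.Cℓ q.Kc q.θ₀ q.B₀ q.δ₀ q.a₁ q.M₁ q.αF q.NH q3.N3 q3.B3 q3.θ3
    NQ q.NI qM.NM qM.BM qM.θM hc hq.α_pos hq.α_lt hq.Nc_nn hq.N'_nn hq.NF_nn hq.one_le_Cℓ hq.Kc_nn hq.θ₀_nn hq.B₀_pos hq.δ₀_pos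
    hq.a₁_pos hq.M₁_pos hq.αF_pos hq.αF_lt.le hq.NH_nn hN3q hB3q hθ3q hq.NI_nn hNMq hBMq hθMq hstA hκA hrdA hlocA h36A h36HA
    hcoA0 hcoA1 hcoA2 hcoA3 hglA0 hglA1 hglA2 hglA3 hlA0 hlA1 hlA2 hlA3 hlA4 hlA5 hH1A hIRA hsymA htrA hcntHA hcnt3A hNQA hcntIA
    hcntMA hq.Bl_nn hq.Bt_nn hq.BI_nn hq.BI2_nn hq.θI_nn
    (scK hm0 hsm hCq ((le_pinLowerB₁' _ _ _ _ _).trans hBq))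
    (scK hAe0 hsL2 (mul_nonneg hCq hL₀0) ((le_pinLowerB₂' _ _ _ _ _).trans hBq)) hδ1.le (min_le_right _ _)
    (sc0 ((le_pinLowerB₃' _ _ _ _ _).trans hBq) hB1)
    (scK hAe0 hsL2 (mul_nonneg hNQ0 hscq) h35q)
    (scK hAe0 hsL2 (mul_nonneg hNQ0 hmcq) hMq)
    (fun β h0 h1 => scK hmLe0 hsmL (hhold_q β h0 h1) (le_max_right _ _))
    (fun ε h0 h1 => scK he0 hse (hin44_q ε h0 h1) (le_max_right _ _))
    (fun ε β h0 h1 hβ0 hβ1 => scK hLe0 hsLe (hin45_q ε β h0 h1 hβ0 hβ1) (le_max_right _ _))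
  exact ⟨t37, c38, t310, rwSumsYieldIneqs_allPins _ 𝔬 (fun _ => 1) H _ _ 𝔬A rdA (fun _ => 1) H _ _ K KA _ _ _
    (mul_pos (lt_of_lt_of_le one_pos hs1) hB1pos) (delta1Y_pos hp hq)⟩

end StageY

end

end Literature.MathematicalPhysics.QuantumFieldTheory.Balaban1983to89.B9RWSumsDefinitePinsPairM
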